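import Literature.Analysis.Quadrature.ProceedingToTheLimit

/-!
# Two-mesh `1/N_k` extrapolation of a cRPA interaction: exactness, the printed sign, and the
# `O(1/N²)` error (Kaltak et al. 2025, §3.3)

For the k-mesh convergence of cRPA interactions Kaltak et al. print: without the long-wave
(head) correction «U depends linearly on the inverse number of k-points used … This allows
extrapolation to infinite k-point sampling», the error «decays with 1/N_k», and at common mesh
densities the uncorrected value is an OVERestimate [KaltakEtAl2025, §3.3; ReddyKaltakKim2025 §III.1
as quoted in the cell's REFVALS-1 §N8(d)].  The two-mesh line through `(1/N₁, U₁)`, `(1/N₂, U₂)`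
evaluated at `1/N = 0` is `U_∞ = (N₂U₂ − N₁U₁)/(N₂ − N₁)` — Richardson's extrapolation to the
limit with tail model `φ = 1/N`, already in the tree as
`Literature.Analysis.Quadrature.richardsonToInfinity` [DavisRabinowitz1984, Sect. 3.2.1]; this file
only SPECIALISES it: `twoMesh_eq_richardsonToInfinity`, exactness on `U(N) = a + c/N`
(`twoMesh_exact`), the printed sign (`c ≥ 0`, `N₁ < N₂` ⇒ `U_∞ ≤ U₂ ≤ U₁`, `twoMesh_le`), and the
exact error on `U(N) = a + c/N + d/N²`: `U_∞^{2-mesh} − a = −d/(N₁N₂)` (`twoMesh_error_eq`), hence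
`|U_∞^{2-mesh} − a| ≤ D/(N₁N₂)` for `|d| ≤ D` (`abs_twoMesh_sub_le`).  Everything proved; no facts.
NOT here: that a given code's mesh error IS of this form (an empirical, printed statement), the
head/long-wave correction itself, anisotropic meshes.

References: M. Kaltak et al., Phys. Rev. B (2025) doi:10.1103/m3gh-g6r6 (arXiv:2508.15368) §3.3 ·
P. J. Davis, P. Rabinowitz, *Methods of Numerical Integration* (1984) Sect. 3.2.1 (via the tree).
AI-produced formalisation (H21, cell hubbard-downfold, seat lit-1, 2026-08-27).
-/

noncomputable section

namespace Literature.MathematicalPhysics.QuantumLattice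

namespace TwoMesh

/-- The two-mesh `1/N` extrapolation `U_∞ = (N₂ U₂ − N₁ U₁)/(N₂ − N₁)` (the line through
`(1/N₁, U₁)`, `(1/N₂, U₂)` at `1/N = 0`). [cite: KaltakEtAl2025, §3.3] -/
def twoMesh (N₁ U₁ N₂ U₂ : ℝ) : ℝ := (N₂ * U₂ - N₁ * U₁) / (N₂ - N₁)

/-- [cite: KaltakEtAl2025, §3.3] Unfolding lemma. -/
theorem twoMesh_def (N₁ U₁ N₂ U₂ : ℝ) :
    twoMesh N₁ U₁ N₂ U₂ = (N₂ * U₂ - N₁ * U₁) / (N₂ - N₁) := rfl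

/-- [cite: DavisRabinowitz1984, Sect. 3.2.1] The two-mesh extrapolation IS Richardson's
extrapolation to the limit with the tail model `φ_n = 1/N_n` on the two-term sequence
`(U₁, U₂)`: `twoMesh N₁ U₁ N₂ U₂ = richardsonToInfinity U φ 0` (`N₁, N₂ ≠ 0`, `N₁ ≠ N₂`). -/
theorem twoMesh_eq_richardsonToInfinity {N₁ N₂ : ℝ} (h1 : N₁ ≠ 0) (h2 : N₂ ≠ 0) (h12 : N₁ ≠ N₂)
    (U₁ U₂ : ℝ) :
    twoMesh N₁ U₁ N₂ U₂ =
      Literature.Analysis.Quadrature.richardsonToInfinity (fun n => if n = 0 then U₁ else U₂)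
        (fun n => if n = 0 then N₁⁻¹ else N₂⁻¹) 0 := by
  unfold twoMesh Literature.Analysis.Quadrature.richardsonToInfinity
  simp only [if_true, one_ne_zero, if_false, zero_add]
  have h21 : N₂ - N₁ ≠ 0 := sub_ne_zero.mpr (Ne.symm h12)
  have h21' : N₂⁻¹ - N₁⁻¹ ≠ 0 := by
    rw [sub_ne_zero]
    exact fun h => h12 (inv_injective h).symm
  field_simp
  ring

/-- **Exactness** [cite: KaltakEtAl2025, §3.3 («U depends linearly on the inverse number of
k-points … allows extrapolation»)]: on an exact `1/N` law `Uᵢ = a + c/Nᵢ` the two-mesh value is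
the limit `a`. -/
theorem twoMesh_exact {N₁ N₂ a c : ℝ} (h1 : N₁ ≠ 0) (h2 : N₂ ≠ 0) (h12 : N₁ ≠ N₂) :
    twoMesh N₁ (a + c / N₁) N₂ (a + c / N₂) = a := by
  unfold twoMesh
  have h21 : N₂ - N₁ ≠ 0 := sub_ne_zero.mpr (Ne.symm h12)
  field_simp
  ring

/-- **The printed sign** [cite: KaltakEtAl2025, §3.3]; [cite: ReddyKaltakKim2025, §III.1
(«overestimated screened U values … for the common k-points density»)]: on an exact law with
`c ≥ 0` (coarse mesh OVERestimates) and `0 < N₁ < N₂`, `U_∞ ≤ U₂ ≤ U₁` — refinement lowers `U`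
monotonically toward the extrapolated value. -/
theorem twoMesh_le {N₁ N₂ a c : ℝ} (h1 : 0 < N₁) (h12 : N₁ < N₂) (hc : 0 ≤ c) :
    twoMesh N₁ (a + c / N₁) N₂ (a + c / N₂) ≤ a + c / N₂ ∧ a + c / N₂ ≤ a + c / N₁ := by
  have h2 : 0 < N₂ := lt_trans h1 h12
  rw [twoMesh_exact h1.ne' h2.ne' h12.ne]
  constructor
  · have : 0 ≤ c / N₂ := by positivity
    linarith
  · have : c / N₂ ≤ c / N₁ := div_le_div_of_nonneg_left hc h1 h12.le
    linarith

/-- **Exact error under a `1/N²` term** [cite: KaltakEtAl2025, §3.3]: if `Uᵢ = a + c/Nᵢ + d/Nᵢ²`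
then `U_∞^{2-mesh} − a = −d/(N₁N₂)`. -/
theorem twoMesh_error_eq {N₁ N₂ a c d : ℝ} (h1 : N₁ ≠ 0) (h2 : N₂ ≠ 0) (h12 : N₁ ≠ N₂) :
    twoMesh N₁ (a + c / N₁ + d / N₁ ^ 2) N₂ (a + c / N₂ + d / N₂ ^ 2) - a = -(d / (N₁ * N₂)) := by
  unfold twoMesh
  have h21 : N₂ - N₁ ≠ 0 := sub_ne_zero.mpr (Ne.symm h12)
  field_simp
  ring

/-- [cite: KaltakEtAl2025, §3.3] Hence `|U_∞^{2-mesh} − a| ≤ D/(N₁N₂)` whenever `|d| ≤ D`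
(`0 < N₁, N₂`). -/
theorem abs_twoMesh_sub_le {N₁ N₂ a c d D : ℝ} (h1 : 0 < N₁) (h2 : 0 < N₂) (h12 : N₁ ≠ N₂)
    (hd : |d| ≤ D) :
    |twoMesh N₁ (a + c / N₁ + d / N₁ ^ 2) N₂ (a + c / N₂ + d / N₂ ^ 2) - a| ≤ D / (N₁ * N₂) := by
  rw [twoMesh_error_eq h1.ne' h2.ne' h12, abs_neg, abs_div,
    abs_of_pos (mul_pos h1 h2)]
  exact div_le_div_of_nonneg_right hd (by positivity)

/-- [cite: KaltakEtAl2025, §3.3] Different `1/N²` coefficients at the two meshes (`d₁`, `d₂`):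
`U_∞^{2-mesh} − a = (d₂/N₂ − d₁/N₁)/(N₂ − N₁)`. -/
theorem twoMesh_error_eq' {N₁ N₂ a c d₁ d₂ : ℝ} (h1 : N₁ ≠ 0) (h2 : N₂ ≠ 0) (h12 : N₁ ≠ N₂) :
    twoMesh N₁ (a + c / N₁ + d₁ / N₁ ^ 2) N₂ (a + c / N₂ + d₂ / N₂ ^ 2) - a
      = (d₂ / N₂ - d₁ / N₁) / (N₂ - N₁) := by
  unfold twoMesh
  have h21 : N₂ - N₁ ≠ 0 := sub_ne_zero.mpr (Ne.symm h12)
  field_simp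
  ring

/-- [cite: KaltakEtAl2025, §3.3] `[float]`-free arithmetic instance for the cell's meshes: with
`N₁ = 4³ = 64` and `N₂ = 6³ = 216` k-points a `1/N²` coefficient `|d| ≤ D` perturbs the two-mesh
value by at most `D/13824`. -/
theorem abs_twoMesh_sub_le_4_6 {a c d D : ℝ} (hd : |d| ≤ D) :
    |twoMesh 64 (a + c / 64 + d / 64 ^ 2) 216 (a + c / 216 + d / 216 ^ 2) - a| ≤ D / 13824 := by
  have h := abs_twoMesh_sub_le (N₁ := 64) (N₂ := 216) (a := a) (c := c) (by norm_num)
    (by norm_num) (by norm_num) hd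
  norm_num at h ⊢
  exact h

end TwoMesh

end Literature.MathematicalPhysics.QuantumLattice
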